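import Mathlib
import HarnessLib
import Summits.HubbardSuperconductivity.HubbardSuperconductivity.Theorems.KLProgrammeKLRegimeVolumeLimitV11TowerDataWOfGridMCov
import Summits.HubbardSuperconductivity.HubbardSuperconductivity.Theorems.KLProgrammeKLRegimeVolumeLimitV11HmisCovRowsOfTowerP

/-!
# Route `KLProgramme` — crux K3, VL child (stmt-HubbardSuperconductivity-20440), window key: `HmisCov` SHRINKS TO ITS ENTRY SUPS AND ITS SCALE-`0` STEP
# (seat hubbard-kl-k3c4-p1 g17; `…V11HmisCovRowsOfTowerP.hmisCovRowsPos_of_towerP` supplies the rows/columns of every step `1 ≤ j < n_β`)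

* `hmisCov_of_entry_zero_rows` — `HmisEntry → HmisZero → HmisCov` pointwise in `(G, P, Q, R)`:
  `HmisEntry` = the ENTRY sups `sE j L` (`→ 0`, `M`-uniform) of `klStepCov (bL) M β μ K_{bL} j − klStepCov (bL) M β μ K_L j`, `j < n_β`;
  `HmisZero` = the rows/columns rates `cR₀ cC₀` (caps `1`, `→ 0`) of the SCALE-`0` step `j = 0` (asked only when `0 < n_β`).
* **`stub_vl_towerDataW_WF2_of_gridM_split`** — `stub_vl_towerData` (v12W) from **HE1 ⊕ HmisEntry ⊕ HmisZero ⊕ Hgrid‴ ⊕ producer** — the INTERFACE OF RECORD under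
  the window key after this file (the transfer half of `Hmis`, the step-covariance rows/columns for `j ≥ 1`, the base's transfer half and `Hcov` are theorems).

Proofs only; no definition; nothing asserts HE1, HmisEntry, HmisZero, Hgrid‴, the producer, any stub, K3, VL or superconductivity.
[cite: BenfattoGiulianiMastropietro2006, §2.7-§2.9 and §3]
-/

noncomputable section

namespace Summit.HubbardSuperconductivity.HubbardSuperconductivity.Theorems.TwoVolumeSource

set_option linter.dupNamespace false -- summit = problem name (single-conjunct summit), D-0017

open Finset Filter Topology Literature.MathematicalPhysics.QuantumLattice GrassmannAlgebra Literature.Probability.LatticeModels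
  Literature.Probability.LatticeModels.BattleFederbush
open Summit.HubbardSuperconductivity.HubbardSuperconductivity.Theorems.TwoPointAssembly
open Summit.HubbardSuperconductivity.HubbardSuperconductivity.Theorems.KLRegimeSplit
open Summit.HubbardSuperconductivity.HubbardSuperconductivity.Theorems.KLProgrammeLegKernels
open Summit.HubbardSuperconductivity.HubbardSuperconductivity.Theorems.EngineV8
open Summit.HubbardSuperconductivity.HubbardSuperconductivity.Theorems.TwoVolumeDefect
open Summit.HubbardSuperconductivity.HubbardSuperconductivity.Theorems.TorusFourierL2

set_option maxHeartbeats 1600000 in -- long binders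
/-- **`HmisEntry → HmisZero → HmisCov`** (see the module docstring): the rows/columns of the steps `1 ≤ j < n_β` are `hmisCovRowsPos_of_towerP`. [folklore: composition] -/
theorem hmisCov_of_entry_zero_rows
    (HmisEntry : ∀ (G : GeoConsts) (P : SplitConsts) (Q : EngConsts) (R : RenConsts), G.WF → P.WF → Q.WF → R.WF2 →
        ∃ c₇ : ℝ, 0 < c₇ ∧ ∀ c : ℝ, 0 < c → c ≤ c₇ → ∃ U₇ : ℝ, 0 < U₇ ∧
          ∀ μ ∈ klWindowC, ∀ U : ℝ, 0 < U → U ≤ U₇ → ∀ β : ℝ, klBetaMin ≤ β → β ≤ Real.exp (c / U ^ 2) →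
            ∀ (K : TrigPolyC4v) (Lstar : ℕ) (Mstar : ℕ → ℕ), TowerP klPredsV17F2 G P Q R β U μ K Lstar Mstar →
            ∃ sE : ℕ → ℕ → ℝ, (∀ j L, 0 ≤ sE j L) ∧ (∀ j, Tendsto (sE j) atTop (𝓝 0)) ∧
            ∃ L₂ : ℕ, ∃ M₂ : ℕ → ℕ → ℕ, ∀ (L b M : ℕ) [NeZero L] [NeZero (b * L)] [NeZero M], L₂ ≤ L → M₂ L b ≤ M →
              ∀ j, j < nScales β → ∀ x y, ‖(klStepCov (b * L) M β μ (klFlowFrameU (b * L) M β U μ (nScales β + 1)) j - klStepCov (b * L) M β μ (klFlowFrameU L M β U μ (nScales β + 1)) j) x y‖ ≤ sE j L)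
    (HmisZero : ∀ (G : GeoConsts) (P : SplitConsts) (Q : EngConsts) (R : RenConsts), G.WF → P.WF → Q.WF → R.WF2 →
        ∃ c₇ : ℝ, 0 < c₇ ∧ ∀ c : ℝ, 0 < c → c ≤ c₇ → ∃ U₇ : ℝ, 0 < U₇ ∧
          ∀ μ ∈ klWindowC, ∀ U : ℝ, 0 < U → U ≤ U₇ → ∀ β : ℝ, klBetaMin ≤ β → β ≤ Real.exp (c / U ^ 2) →
            ∀ (K : TrigPolyC4v) (Lstar : ℕ) (Mstar : ℕ → ℕ), TowerP klPredsV17F2 G P Q R β U μ K Lstar Mstar →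
            ∃ cR₀ cC₀ : ℕ → ℝ, (∀ L, 0 ≤ cR₀ L ∧ 0 ≤ cC₀ L ∧ cR₀ L ≤ 1 ∧ cC₀ L ≤ 1) ∧ (Tendsto cR₀ atTop (𝓝 0) ∧ Tendsto cC₀ atTop (𝓝 0)) ∧
            ∃ L₂ : ℕ, ∃ M₂ : ℕ → ℕ → ℕ, ∀ (L b M : ℕ) [NeZero L] [NeZero (b * L)] [NeZero M], L₂ ≤ L → M₂ L b ≤ M → 0 < nScales β →
              (∀ x, ∑ y, ‖(klStepCov (b * L) M β μ (klFlowFrameU (b * L) M β U μ (nScales β + 1)) 0 - klStepCov (b * L) M β μ (klFlowFrameU L M β U μ (nScales β + 1)) 0) x y‖ ≤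
                cR₀ L / imagTimeWeight β M) ∧
              (∀ y, ∑ x, ‖(klStepCov (b * L) M β μ (klFlowFrameU (b * L) M β U μ (nScales β + 1)) 0 - klStepCov (b * L) M β μ (klFlowFrameU L M β U μ (nScales β + 1)) 0) x y‖ ≤
                cC₀ L / imagTimeWeight β M))
    (G : GeoConsts) (P : SplitConsts) (Q : EngConsts) (R : RenConsts) (hG : G.WF) (hP : P.WF) (hQ : Q.WF) (hR2 : R.WF2) :
        ∃ c₇ : ℝ, 0 < c₇ ∧ ∀ c : ℝ, 0 < c → c ≤ c₇ → ∃ U₇ : ℝ, 0 < U₇ ∧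
          ∀ μ ∈ klWindowC, ∀ U : ℝ, 0 < U → U ≤ U₇ → ∀ β : ℝ, klBetaMin ≤ β → β ≤ Real.exp (c / U ^ 2) →
            ∀ (K : TrigPolyC4v) (Lstar : ℕ) (Mstar : ℕ → ℕ), TowerP klPredsV17F2 G P Q R β U μ K Lstar Mstar →
            ∃ (sE cR cC : ℕ → ℕ → ℝ),
              (∀ j L, 0 ≤ sE j L ∧ 0 ≤ cR j L ∧ 0 ≤ cC j L ∧ cR j L ≤ 1 ∧ cC j L ≤ 1) ∧
              (∀ j, Tendsto (sE j) atTop (𝓝 0) ∧ Tendsto (cR j) atTop (𝓝 0) ∧ Tendsto (cC j) atTop (𝓝 0)) ∧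
            ∃ L₂ : ℕ, ∃ M₂ : ℕ → ℕ → ℕ, ∀ (L b M : ℕ) [NeZero L] [NeZero (b * L)] [NeZero M], L₂ ≤ L → M₂ L b ≤ M →
              (∀ j, j < nScales β → ∀ x y, ‖(klStepCov (b * L) M β μ (klFlowFrameU (b * L) M β U μ (nScales β + 1)) j - klStepCov (b * L) M β μ (klFlowFrameU L M β U μ (nScales β + 1)) j) x y‖ ≤ sE j L) ∧
              (∀ j, j < nScales β → ∀ x, ∑ y, ‖(klStepCov (b * L) M β μ (klFlowFrameU (b * L) M β U μ (nScales β + 1)) j - klStepCov (b * L) M β μ (klFlowFrameU L M β U μ (nScales β + 1)) j) x y‖ ≤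
                cR j L / imagTimeWeight β M) ∧
              (∀ j, j < nScales β → ∀ y, ∑ x, ‖(klStepCov (b * L) M β μ (klFlowFrameU (b * L) M β U μ (nScales β + 1)) j - klStepCov (b * L) M β μ (klFlowFrameU L M β U μ (nScales β + 1)) j) x y‖ ≤
                cC j L / imagTimeWeight β M) := by
  classical
  obtain ⟨c₄, hc₄, hent⟩ := HmisEntry G P Q R hG hP hQ hR2
  obtain ⟨c₅, hc₅, hzer⟩ := HmisZero G P Q R hG hP hQ hR2
  obtain ⟨c₆, hc₆, hpos⟩ := hmisCovRowsPos_of_towerP G P Q R hR2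
  refine ⟨min c₄ (min c₅ c₆), lt_min hc₄ (lt_min hc₅ hc₆), fun c hc hcc => ?_⟩
  have hc4 : c ≤ c₄ := hcc.trans (min_le_left _ _)
  have hc5 : c ≤ c₅ := hcc.trans ((min_le_right _ _).trans (min_le_left _ _))
  have hc6 : c ≤ c₆ := hcc.trans ((min_le_right _ _).trans (min_le_right _ _))
  obtain ⟨U₄, hU₄, hent'⟩ := hent c hc hc4
  obtain ⟨U₅, hU₅, hzer'⟩ := hzer c hc hc5
  obtain ⟨U₆, hU₆, hpos'⟩ := hpos c hc hc6
  refine ⟨min U₄ (min U₅ U₆), lt_min hU₄ (lt_min hU₅ hU₆), fun μ hμ U hU hUU β hβmin hβc K Lstar Mstar hT => ?_⟩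
  have hU4 : U ≤ U₄ := hUU.trans (min_le_left _ _)
  have hU5 : U ≤ U₅ := hUU.trans ((min_le_right _ _).trans (min_le_left _ _))
  have hU6 : U ≤ U₆ := hUU.trans ((min_le_right _ _).trans (min_le_right _ _))
  obtain ⟨sE, hsE0, hsElim, L₄, M₄, hEI⟩ := hent' μ hμ U hU hU4 β hβmin hβc K Lstar Mstar hT
  obtain ⟨cR₀, cC₀, hz0, hzlim, L₅, M₅, hZI⟩ := hzer' μ hμ U hU hU5 β hβmin hβc K Lstar Mstar hT
  obtain ⟨cRp, cCp, hp0, hplim, L₆, M₆, hPI⟩ := hpos' μ hμ U hU hU6 β hβmin hβc K Lstar Mstar hT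
  refine ⟨sE, fun j L => Nat.casesOn j (cR₀ L) (fun m => cRp (m + 1) L), fun j L => Nat.casesOn j (cC₀ L) (fun m => cCp (m + 1) L),
    fun j L => ?_, fun j => ?_, max L₄ (max L₅ L₆), fun L b => max (M₄ L b) (max (M₅ L b) (M₆ L b)), fun L b M _ _ _ hL hM => ?_⟩
  · cases j with
    | zero => exact ⟨hsE0 0 L, (hz0 L).1, (hz0 L).2.1, (hz0 L).2.2.1, (hz0 L).2.2.2⟩
    | succ m => exact ⟨hsE0 (m + 1) L, (hp0 (m + 1) L).1, (hp0 (m + 1) L).2.1, (hp0 (m + 1) L).2.2.1, (hp0 (m + 1) L).2.2.2⟩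
  · cases j with
    | zero => exact ⟨hsElim 0, hzlim.1, hzlim.2⟩
    | succ m => exact ⟨hsElim (m + 1), (hplim (m + 1)).1, (hplim (m + 1)).2⟩
  · have hL4 : L₄ ≤ L := le_trans (le_max_left _ _) hL
    have hL5 : L₅ ≤ L := le_trans ((le_max_left _ _).trans (le_max_right _ _)) hL
    have hL6 : L₆ ≤ L := le_trans ((le_max_right _ _).trans (le_max_right _ _)) hL
    have hM4 : M₄ L b ≤ M := le_trans (le_max_left _ _) hM
    have hM5 : M₅ L b ≤ M := le_trans ((le_max_left _ _).trans (le_max_right _ _)) hM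
    have hM6 : M₆ L b ≤ M := le_trans ((le_max_right _ _).trans (le_max_right _ _)) hM
    obtain ⟨hPr, hPc⟩ := hPI L b M hL6 hM6
    refine ⟨hEI L b M hL4 hM4, fun j hj x => ?_, fun j hj y => ?_⟩
    · cases j with
      | zero => exact (hZI L b M hL5 hM5 hj).1 x
      | succ m => exact hPr (m + 1) (Nat.succ_le_succ (Nat.zero_le _)) hj x
    · cases j with
      | zero => exact (hZI L b M hL5 hM5 hj).2 y
      | succ m => exact hPc (m + 1) (Nat.succ_le_succ (Nat.zero_le _)) hj y

set_option maxHeartbeats 1600000 in -- long binders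
/-- **`stub_vl_towerData` (v12W) FROM `HE1`, `HmisEntry`, `HmisZero`, p3's `Hgrid‴` AND THE PRODUCER TEXT.** [folklore: composition; cite: BenfattoGiulianiMastropietro2006, §2.7-§2.9 and §3] -/
theorem stub_vl_towerDataW_WF2_of_gridM_split
    (HE1 : ∀ (G : GeoConsts) (P : SplitConsts) (Q : EngConsts) (R : RenConsts), G.WF → P.WF → Q.WF → R.WF2 →
      ∃ C₀ : ℝ, 0 ≤ C₀ ∧
        ∃ c₇ : ℝ, 0 < c₇ ∧ ∀ c : ℝ, 0 < c → c ≤ c₇ → ∃ U₇ : ℝ, 0 < U₇ ∧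
          ∀ μ ∈ klWindowC, ∀ U : ℝ, 0 < U → U ≤ U₇ → ∀ β : ℝ, klBetaMin ≤ β → β ≤ Real.exp (c / U ^ 2) →
            ∀ (K : TrigPolyC4v) (Lstar : ℕ) (Mstar : ℕ → ℕ), TowerP klPredsV17F2 G P Q R β U μ K Lstar Mstar →
            ∃ S₀ : ℕ → ℕ → ℝ, (∀ j m, 0 ≤ S₀ j m) ∧ (∀ j, j ≤ nScales β → ∀ m, 1 ≤ m → S₀ j (2 * m) ≤ C₀ * klWtBudget P Q U (j + 1) (2 * m)) ∧
            ∃ L₂ : ℕ, ∃ M₂ : ℕ → ℕ, ∀ (L M : ℕ) [NeZero L] [NeZero M], L₂ ≤ L → M₂ L ≤ M →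
              (∀ k, k ≤ nScales β → hubbardEffPartitionFnCT L M β U μ 0 (klFlowFrameU L M β U μ (nScales β + 1)) (klScale klE0 (k + 1)) ≠ 0) ∧
              (∀ j, j ≤ nScales β → ∀ (m : ℕ) (q : Fin m) (w : SpaceTimeIdx L M × SectorLeg (sectorCount j)),
                klWtPinnedSumAt L M β μ (klFlowFrameU L M β U μ (nScales β + 1)) j j m (klEffectiveAction L M β U μ (klFlowFrameU L M β U μ (nScales β + 1)) klE0 (j + 1)) q w ≤ S₀ j m))
    (HmisEntry : ∀ (G : GeoConsts) (P : SplitConsts) (Q : EngConsts) (R : RenConsts), G.WF → P.WF → Q.WF → R.WF2 →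
        ∃ c₇ : ℝ, 0 < c₇ ∧ ∀ c : ℝ, 0 < c → c ≤ c₇ → ∃ U₇ : ℝ, 0 < U₇ ∧
          ∀ μ ∈ klWindowC, ∀ U : ℝ, 0 < U → U ≤ U₇ → ∀ β : ℝ, klBetaMin ≤ β → β ≤ Real.exp (c / U ^ 2) →
            ∀ (K : TrigPolyC4v) (Lstar : ℕ) (Mstar : ℕ → ℕ), TowerP klPredsV17F2 G P Q R β U μ K Lstar Mstar →
            ∃ sE : ℕ → ℕ → ℝ, (∀ j L, 0 ≤ sE j L) ∧ (∀ j, Tendsto (sE j) atTop (𝓝 0)) ∧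
            ∃ L₂ : ℕ, ∃ M₂ : ℕ → ℕ → ℕ, ∀ (L b M : ℕ) [NeZero L] [NeZero (b * L)] [NeZero M], L₂ ≤ L → M₂ L b ≤ M →
              ∀ j, j < nScales β → ∀ x y, ‖(klStepCov (b * L) M β μ (klFlowFrameU (b * L) M β U μ (nScales β + 1)) j - klStepCov (b * L) M β μ (klFlowFrameU L M β U μ (nScales β + 1)) j) x y‖ ≤ sE j L)
    (HmisZero : ∀ (G : GeoConsts) (P : SplitConsts) (Q : EngConsts) (R : RenConsts), G.WF → P.WF → Q.WF → R.WF2 →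
        ∃ c₇ : ℝ, 0 < c₇ ∧ ∀ c : ℝ, 0 < c → c ≤ c₇ → ∃ U₇ : ℝ, 0 < U₇ ∧
          ∀ μ ∈ klWindowC, ∀ U : ℝ, 0 < U → U ≤ U₇ → ∀ β : ℝ, klBetaMin ≤ β → β ≤ Real.exp (c / U ^ 2) →
            ∀ (K : TrigPolyC4v) (Lstar : ℕ) (Mstar : ℕ → ℕ), TowerP klPredsV17F2 G P Q R β U μ K Lstar Mstar →
            ∃ cR₀ cC₀ : ℕ → ℝ, (∀ L, 0 ≤ cR₀ L ∧ 0 ≤ cC₀ L ∧ cR₀ L ≤ 1 ∧ cC₀ L ≤ 1) ∧ (Tendsto cR₀ atTop (𝓝 0) ∧ Tendsto cC₀ atTop (𝓝 0)) ∧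
            ∃ L₂ : ℕ, ∃ M₂ : ℕ → ℕ → ℕ, ∀ (L b M : ℕ) [NeZero L] [NeZero (b * L)] [NeZero M], L₂ ≤ L → M₂ L b ≤ M → 0 < nScales β →
              (∀ x, ∑ y, ‖(klStepCov (b * L) M β μ (klFlowFrameU (b * L) M β U μ (nScales β + 1)) 0 - klStepCov (b * L) M β μ (klFlowFrameU L M β U μ (nScales β + 1)) 0) x y‖ ≤
                cR₀ L / imagTimeWeight β M) ∧
              (∀ y, ∑ x, ‖(klStepCov (b * L) M β μ (klFlowFrameU (b * L) M β U μ (nScales β + 1)) 0 - klStepCov (b * L) M β μ (klFlowFrameU L M β U μ (nScales β + 1)) 0) x y‖ ≤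
                cC₀ L / imagTimeWeight β M))
    (HgridM : ∀ (G : GeoConsts) (P : SplitConsts) (Q : EngConsts) (R : RenConsts), G.WF → P.WF → Q.WF → R.WF2 →
        ∃ c₇ : ℝ, 0 < c₇ ∧ ∀ c : ℝ, 0 < c → c ≤ c₇ → ∃ U₇ : ℝ, 0 < U₇ ∧
          ∀ μ ∈ klWindowC, ∀ U : ℝ, 0 < U → U ≤ U₇ → ∀ β : ℝ, klBetaMin ≤ β → β ≤ Real.exp (c / U ^ 2) →
            ∀ (K : TrigPolyC4v) (Lstar : ℕ) (Mstar : ℕ → ℕ), TowerP klPredsV17F2 G P Q R β U μ K Lstar Mstar →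
            ∃ (κE aC cb κg κg' ρS ρg' ρg₂ ρgf aw al al' mo mo' s s' Θ νW νf νg₂ νD : ℝ) (sgE cc eE tT Te : ℕ → ℝ),
              (0 < κE ∧ 0 < aC ∧ 0 < κg ∧ 0 < κg' ∧ 0 < ρS ∧ 0 < ρg' ∧ 0 < ρg₂ ∧ 0 < ρgf ∧ 0 < aw ∧ 0 < al' + al ∧ 0 ≤ mo ∧ 0 ≤ mo' ∧ 0 ≤ s ∧ 0 ≤ s' ∧
                0 ≤ Θ ∧ 0 ≤ νW ∧ 0 ≤ νf ∧ 0 ≤ νg₂) ∧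
              (Real.exp 1 * (aC + cb) * νW / κE ^ 2 < 1 ∧ Real.exp 1 * aw * Θ / κg' ^ 2 < 1 ∧
                Real.exp 1 * (al' + al + (mo' + mo)) * νf / (κg' + κg) ^ 2 < 1 ∧
                Real.exp 1 * (al' + al + (mo' + mo)) * νg₂ / (κg' + κg + (κg' + κg + (κg' + κg))) ^ 2 < 1) ∧
              (∀ L, 0 ≤ sgE L ∧ 0 ≤ cc L ∧ 2 * cc L ≤ cb ∧ 0 < tT L ∧ 0 ≤ Te L) ∧
              (Tendsto sgE atTop (𝓝 0) ∧ Tendsto cc atTop (𝓝 0) ∧ Tendsto eE atTop (𝓝 0) ∧ Tendsto tT atTop (𝓝 0) ∧ Tendsto Te atTop (𝓝 0)) ∧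
            ∃ L₂ : ℕ, ∃ M₂ : ℕ → ℕ → ℕ, ∀ (L b M : ℕ) [NeZero L] [NeZero (b * L)] [NeZero M], L₂ ≤ L → M₂ L b ≤ M →
              Nonempty (TowerGridDataM L b M β U μ (klFlowFrameU L M β U μ (nScales β + 1)) (klFlowFrameU (b * L) M β U μ (nScales β + 1)) (imagTimeWeight β M)
                κE aC κg κg' ρS ρg' ρg₂ ρgf aw al al' mo mo' s s' Θ νW νf νg₂ νD
                (sgE L) (cc L) (eE L) (tT L) (Te L) (Nat.sqrt (L / (4 * nScales β + 7))) ((L / (4 * nScales β + 7)) - Nat.sqrt (L / (4 * nScales β + 7)))))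
    (hSrc : ∀ (P : SplitConsts) (R : RenConsts), P.WF → R.WF2 →
      ∃ Q' : EngConsts, 0 ≤ Q'.CE ∧ ∃ c₀ : ℝ, 0 < c₀ ∧ ∀ c : ℝ, 0 < c → c ≤ c₀ → ∃ U₀ : ℝ, 0 < U₀ ∧
        ∀ μ ∈ klWindowC, ∀ U : ℝ, 0 < U → U ≤ U₀ → ∀ β : ℝ, klBetaMin ≤ β → β ≤ Real.exp (c / U ^ 2) →
          ∃ A : ℕ → ℕ → ℝ, ∃ L₁ : ℕ, ∃ M₁ : ℕ → ℕ, ∀ (L M : ℕ) [NeZero L] [NeZero M], L₁ ≤ L → M₁ L ≤ M →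
            ∀ j : ℕ, j + 1 ≤ nScales β + 1 →
              SourceProfilesAtLev L M (klSrcBudget P Q' U A (j + 1)) β U μ (klFlowFrameU L M β U μ (nScales β + 1)) j j (j + 1))
    (G : GeoConsts) (P : SplitConsts) (Q : EngConsts) (R : RenConsts) (hG : G.WF) (hP : P.WF) (hQ : Q.WF) (hR2 : R.WF2) :
    ∃ c₅ : ℝ, 0 < c₅ ∧ ∀ c : ℝ, 0 < c → c ≤ c₅ → ∃ U₀ : ℝ, 0 < U₀ ∧
      ∀ μ ∈ klWindowC, ∀ U : ℝ, 0 < U → U ≤ U₀ → ∀ β : ℝ, klBetaMin ≤ β → β ≤ Real.exp (c / U ^ 2) →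
        ∀ K : TrigPolyC4v, klPredsV17F2.frameOK R U (nScales β) μ K →
          ∀ (Lstar : ℕ) (Mstar : ℕ → ℕ), TowerP klPredsV17F2 G P Q R β U μ K Lstar Mstar →
            ∃ t : ℝ, 0 < t ∧ t ≤ 1 ∧ Nonempty (TowerDataTSW β U μ t) :=
  stub_vl_towerDataW_WF2_of_gridM_cov HE1 (fun G P Q R hG hP hQ hR2 => hmisCov_of_entry_zero_rows HmisEntry HmisZero G P Q R hG hP hQ hR2) HgridM hSrc
    G P Q R hG hP hQ hR2

end Summit.HubbardSuperconductivity.HubbardSuperconductivity.Theorems.TwoVolumeSource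

end
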